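/-
Copyright (c) 2026. All rights reserved.
Released under Apache 2.0 license as described in the file LICENSE.
-/
import Literature.AlgebraicGeometry.Resolution.WeightedCentrePowPairMax
import Literature.AlgebraicGeometry.Resolution.WeightedCentreGraphRestriction
import Literature.AlgebraicGeometry.Resolution.WeightedCentreResidualOrder
import HarnessLib

/-!
# Split maxima of purely inseparable equations `X_a^q + h`: the first two entries, and the
# family `x^p + y^p(1 + y^r)`

Synthesis of the three residual files of the polynomial weighted-centre model
(`WeightedCentreResidualLower`: Lemma L, the transport `W(X_a^q + h) = W(X_a^q + (h − γ^q))`;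
`WeightedCentreGraphRestriction`: Lemma S, a maximal centre with an `X_a`-regular affine slot of
entry `≤ q` has entry `q` there and its deleted invariant is `max C_q(h)`;
`WeightedCentreResidualOrder`: Lemma N, `max C_q(h)` starts with the residual order `ν_q(h)`),
[cite: AbramovichTemkinWlodarczyk2024, §5.1 (p. 1575), Thm. 5.3.1 (2)–(3) (p. 1578)];
[cite: HauserPerlega2019, §2 (cleaning; residual order of z^{p^e} + F)]:

* `exists_exps_eq_insertionSort_of_graph` : in characteristic `p`, `q = p^n`, if `max W(X_a^q + h)`
  is attained by a centre with an `X_a`-regular affine coordinate of entry `≤ q`, and `ν = ν_q(h)` is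
  witnessed (a non-`q`-divisible monomial of degree `ν` and a cleaning to order `ν`), then
  `max W(X_a^q + h) = sort (q, ν, …)` — the census's SPLIT LAW with its first residual entry;
* `isMaxInv_X_pow_add_X_pow_add_X_pow` : for every prime `p` and `p ∤ r`,
  `max W(x^p + y^p + y^{p+r}) = (p, p + r)` over every field of characteristic `p`, spectator
  variables allowed — the value of the purely inseparable equation `x^p + y^p(1 + y^r)` (engine 1
  FE36 Thm G/H at `e = 1`; `r = 1` is the kangaroo equation): clean `y^p` by the shear
  `x ↦ x − y` (transport) and read off `max W(x^p + y^{p+r}) = (p, p + r)` from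
  `WeightedCentrePowPairMax` (`p ∤ p + r`).

Value type: theorems in the polynomial weighted-centre model — NOT a resolution theorem.
-/

namespace Literature.AlgebraicGeometry.Resolution.WeightedBlowup

open MvPolynomial

variable {k : Type*} [Field k] {N : ℕ}

/-! ## §1 The split law with its first residual entry -/

/-- **Split law, first two entries (engine 1 FE35 LAW 1 + Lemma N), typed:** in characteristic `p`,
`q = p^n`, let `(Ψ, w)` realise `max W(X_a^q + h)` (`h` free of `X_a`) with an `X_a`-regular AFFINE
coordinate `z_j = c·X_a + ψ` of entry `1/w_j ≤ q`; let `X^d` be a monomial of `h` with an exponent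
not divisible by `q` and `γ₀` (free of `X_a`, `γ₀(0) = 0`) a cleaning with `ord (h − γ₀^q) = |d|`.
Then `max W(X_a^q + h) = sort (q, |d|, rest)`: the entry of `z_j` is `q` (Lemma S), the deleted
invariant is `max C_q(h)` (Lemma S), whose first entry is `|d| = ν_q(h)` (Lemma N). (derived here)
[cite: AbramovichTemkinWlodarczyk2024, Thm. 5.3.1 (2)–(3) (p. 1578)];
[cite: HauserPerlega2019, §2 (residual order)] -/
theorem exists_exps_eq_insertionSort_of_graph (p n : ℕ) [Fact p.Prime] [CharP k p] (a : Fin N)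
    {h γ₀ : MvPolynomial (Fin N) k} (hh : a ∉ h.vars)
    {Ψ : MvPolynomial (Fin N) k ≃ₐ[k] MvPolynomial (Fin N) k} {w : Fin N → ℚ}
    (hc : IsCentreFor (X a ^ p ^ n + h) Ψ w)
    (hmax : IsMaxInv (admissibleInvariants (X a ^ p ^ n + h)) (exps w))
    {j : Fin N} {c : k} {ψ : MvPolynomial (Fin N) k} (hc0 : c ≠ 0) (hψ : a ∉ ψ.vars)
    (hj : Ψ (X j) = C c * X a + ψ) (hwj : w j ≠ 0) (hle : (w j)⁻¹ ≤ (p ^ n : ℕ))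
    {d : Fin N →₀ ℕ} (hdh : d ∈ h.support) (hd : ∃ i, ¬ p ^ n ∣ d i) (hγa : a ∉ γ₀.vars)
    (hγ0 : constantCoeff γ₀ = 0) (hν : monomialOrd (fun _ => 1) (h - γ₀ ^ p ^ n) = (d.degree : ℕ)) :
    ∃ es, exps w = (((p ^ n : ℕ) : ℚ) :: ((d.degree : ℕ) : ℚ) :: es).insertionSort (· ≤ ·) := by
  obtain ⟨-, hres, hexps⟩ := isMaxInv_residualInvariants_of_graph p n a hh hc hmax hc0 hψ hj hwj hle
  obtain ⟨es, hes⟩ := exists_eq_cons_of_isMaxInv_residualInvariants p n a hh hdh hd hγa hγ0 hν hres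
  exact ⟨es, by rw [hexps, hes]⟩

/-! ## §2 The family `x^p + y^p (1 + y^r)`, `p ∤ r` -/

/-- `x` does not occur in `y^p + y^{p+r}` (plumbing). [folklore] -/
private theorem notMem_vars_X_pow_add_X_pow₁₆ {a b : Fin N} (hab : a ≠ b) (p r : ℕ) :
    a ∉ (X b ^ p + X b ^ (p + r) : MvPolynomial (Fin N) k).vars := by
  classical
  intro ha
  rcases Finset.mem_union.mp (vars_add_subset _ _ ha) with ha | ha
  · have ha' := vars_pow _ _ ha
    rw [vars_X, Finset.mem_singleton] at ha'
    exact hab ha'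
  · have ha' := vars_pow _ _ ha
    rw [vars_X, Finset.mem_singleton] at ha'
    exact hab ha'

/-- **`max W(x^p + y^p + y^{p+r}) = (p, p + r)` for every prime `p` and `p ∤ r`** (characteristic `p`,
`x = X_a ≠ y = X_b`, any number of spectator variables): the maximal invariant of the purely
inseparable equation `x^p + y^p(1 + y^r)` over ALL polynomial coordinate changes.  Proof: the shear
`x ↦ x − y` cleans `y^p` (`W(X_a^p + h) = W(X_a^p + (h − y^p))`, `WeightedCentreResidualLower`), and
`max W(x^p + y^{p+r}) = (p, p + r)` because `p ∤ p + r` (`isMaxInv_powPair_of_not_dvd`: the vertex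
`(p+r)/p` of the characteristic polyhedron is not a lattice point, hence not solvable).  This is the
`e = 1` value of engine 1's one-variable bending law (FE36 Thm G/H: split, `(p, p + r)`); for
`q = p^e`, `e ≥ 2`, the maximum bends to the non-split `(p, q + r(q−1)/(p−1))` and is NOT claimed.
(derived here) [cite: AbramovichTemkinWlodarczyk2024, Thm. 5.3.1 (2)–(3) (p. 1578)];
[cite: CossartJannsenSaito2020, Thm. 8.16 (p. 121) (solvable vertices)];
[cite: Hauser2010, (the kangaroo equation z^p + y^p(1 + y), r = 1)] -/
theorem isMaxInv_X_pow_add_X_pow_add_X_pow (p : ℕ) [hp : Fact p.Prime] [CharP k p] {a b : Fin N}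
    (hab : a ≠ b) {r : ℕ} (hr : ¬ p ∣ r) :
    IsMaxInv (admissibleInvariants (X a ^ p + (X b ^ p + X b ^ (p + r)) : MvPolynomial (Fin N) k))
      [(p : ℚ), ((p + r : ℕ) : ℚ)] := by
  classical
  have hr0 : r ≠ 0 := fun h0 => hr (h0 ▸ dvd_zero p)
  have hp2 : 2 ≤ p := hp.out.two_le
  have hndvd : ¬ p ∣ p + r := fun hdvd => hr ((Nat.dvd_add_right (dvd_refl p)).mp hdvd)
  have hpair := isMaxInv_powPair_of_not_dvd (k := k) hab hp2 (by omega : p < p + r) hndvd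
  rw [powPair_eq] at hpair
  have hγ : a ∉ (X b : MvPolynomial (Fin N) k).vars := by
    rw [vars_X, Finset.mem_singleton]
    exact hab
  have hsub : (X b ^ p + X b ^ (p + r) : MvPolynomial (Fin N) k) - X b ^ p ^ 1 = X b ^ (p + r) := by
    ring
  have key := isMaxInv_X_pow_add_of_sub_pow p 1 a (notMem_vars_X_pow_add_X_pow₁₆ hab p r) hγ
    (constantCoeff_X k b) (v := [(p : ℚ), ((p + r : ℕ) : ℚ)]) (by rw [hsub, pow_one]; exact hpair)
  rwa [pow_one] at key

/-- The kangaroo equation itself (`r = 1`): `max W(x^p + y^p + y^{p+1}) = (p, p + 1)` in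
characteristic `p`. (derived here) [cite: Hauser2010, (kangaroo points: z^p + y^p(1 + y))];
[cite: AbramovichTemkinWlodarczyk2024, Thm. 5.3.1 (2)–(3) (p. 1578)] -/
theorem isMaxInv_kangaroo (p : ℕ) [hp : Fact p.Prime] [CharP k p] {a b : Fin N} (hab : a ≠ b) :
    IsMaxInv (admissibleInvariants (X a ^ p + (X b ^ p + X b ^ (p + 1)) : MvPolynomial (Fin N) k))
      [(p : ℚ), ((p + 1 : ℕ) : ℚ)] :=
  isMaxInv_X_pow_add_X_pow_add_X_pow p hab (r := 1) (fun h1 => hp.out.one_lt.ne' (Nat.dvd_one.mp h1))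

end Literature.AlgebraicGeometry.Resolution.WeightedBlowup
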